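import Literature.Geometry.Kaehler.GrauertOkaPrincipleProofs
import Literature.Analysis.Complex.ContinuousCocyclesAffine
import Mathlib.Analysis.Matrix.Normed
import HarnessLib

/-!
# Grauert's Oka principle (existence half) over the model space `ℂⁿ`

The named fact `Literature.Geometry.Kaehler.grauert_oka_exists_holomorphic` (Fritzsche–Grauert,
Ch. V §1.5 (1)) asserts, for every Stein manifold `M`, that every `C^∞` complex vector bundle
(`GL_r(ℂ)`-cocycle) over `M` is topologically equivalent to a holomorphic one. This file PROVES the
case `M = E ≅ ℂⁿ` (the model vector space as a manifold over itself, which is Stein: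
`Literature.Analysis.Complex.isSteinManifold_self`):

* `SmoothComplexVectorBundle.exists_continuous_coboundary_self` — the transition cocycle `g_{ij}`
  of a bundle over `E` is a continuous coboundary, `g_{ij} = F_i F_j⁻¹` with continuous
  `F_i : U_i → GL_r(ℂ)` (topological triviality of bundles over `ℂⁿ`,
  `Literature.Analysis.Complex.ContCocycle.exists_continuous_coboundary`, transported along a
  linear isomorphism `E ≃ ℂⁿ`; matrices normed by the operator sup-norm
  `Matrix.Norms.Operator`);
* `grauert_oka_exists_holomorphic_modelSpace` — hence `V` is topologically equivalent to a
  holomorphic cocycle: regauging by `c_i = F_i⁻¹` makes all transition matrices `≡ 1`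
  (`exists_isHolomorphic_topologicallyEquivalent_of_cochain`);
* `grauert_oka_exists_holomorphic_of_modelSpace` — the same in the exact shape of the named fact
  for `M := E` (index type in the universe of `M`, via `reindexRange`);
* `grauert_oka_exists_holomorphic_of_homeomorph` (`'`) — more generally for every complex manifold
  `M` HOMEOMORPHIC to `ℂⁿ` (balls, polydiscs, boxes, …): only the topology of the base enters the
  coboundary (`exists_continuous_coboundary_of_homeomorph`).

This is Leiterer's deduction "`f = c □ 1` continuously, hence `c⁻¹ □ f = 1` is holomorphic"
(SCV IV, Ch. II, Thm. 3.2 (ii) / Cor. 3.3 (ii)) in the one case where the continuous coboundary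
comes for free from the topology of the base; for a general Stein manifold the coboundary exists
only after Grauert's bumping (Leiterer §§4–6), which is the open part of the fact.

## References

* K. Fritzsche, H. Grauert, *From Holomorphic Functions to Complex Manifolds* (2002), Ch. V §1.5
  [FritzscheGrauert2002].
* J. Leiterer, in: Several Complex Variables IV (1990), Ch. II, Thm. 3.2 (ii), Cor. 3.3
  [LeitererSCV4].
-/

noncomputable section

open scoped Manifold ContDiff Topology Matrix.Norms.Operator
open Set

namespace Literature.Geometry.Kaehler

namespace SmoothComplexVectorBundle

universe u w

variable {E : Type u} [NormedAddCommGroup E] [NormedSpace ℂ E] [FiniteDimensional ℂ E]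
  {ι : Type w} {r : ℕ}

/-- **Bundles over `ℂⁿ` are topologically trivial, cocycle form.** The transition matrices of a
`C^∞` complex vector bundle over the model space `E ≅ ℂⁿ` form a continuous coboundary:
`g_{ij} = F_i F_j⁻¹` on `U_i ∩ U_j` with `F_i` continuous and invertible on `U_i`.
[cite: LeitererSCV4, Ch. II Thm. 3.2 (ii) (the case X = ℂⁿ)] -/
theorem exists_continuous_coboundary_self (V : SmoothComplexVectorBundle ι E E r) :
    ∃ F : ι → E → Matrix (Fin r) (Fin r) ℂ, (∀ i, ContinuousOn (F i) (V.baseSet i)) ∧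
      (∀ i, ∀ x ∈ V.baseSet i, IsUnit (F i x)) ∧
      ∀ i j, ∀ x ∈ V.baseSet i ∩ V.baseSet j, V.coordChange i j x = F i x * Ring.inverse (F j x) := by
  classical
  set n : ℕ := Module.finrank ℂ E with hn
  have hrank : Module.finrank ℂ E = Module.finrank ℂ (Fin n → ℂ) := by simp [hn]
  set e : E ≃L[ℂ] (Fin n → ℂ) := ContinuousLinearEquiv.ofFinrankEq hrank with he
  haveI : CompleteSpace (Matrix (Fin r) (Fin r) ℂ) := FiniteDimensional.complete ℂ _
  -- continuity of the matrix-valued transition functions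
  have hcont : ∀ i j, ContinuousOn (V.coordChange i j) (V.baseSet i ∩ V.baseSet j) := by
    intro i j
    refine continuousOn_pi.2 fun a ↦ continuousOn_pi.2 fun b ↦ ?_
    exact (V.contMDiffOn_coordChange i j a b).continuousOn
  -- the transported continuous cocycle on `ℂⁿ`
  let 𝓖 : Literature.Analysis.Complex.ContCocycle (Fin n) (Matrix (Fin r) (Fin r) ℂ) ι :=
    { U := fun i ↦ e.symm ⁻¹' V.baseSet i
      isOpen_U := fun i ↦ (V.isOpen_baseSet i).preimage e.symm.continuous
      exists_mem := fun z ↦ V.exists_mem_baseSet (e.symm z)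
      g := fun i j z ↦ V.coordChange i j (e.symm z)
      continuousOn_g := fun i j ↦ (hcont i j).comp e.symm.continuous.continuousOn fun _ hz ↦ hz
      g_self := fun i z hz ↦ V.coordChange_self i _ hz
      g_comp := fun i j k z hz ↦ V.coordChange_comp i j k _ hz }
  obtain ⟨F, hFc, hFu, hFeq⟩ := 𝓖.exists_continuous_coboundary
  have hmem : ∀ i x, x ∈ V.baseSet i → e x ∈ 𝓖.U i := fun i x hx ↦ by
    show e.symm (e x) ∈ V.baseSet i
    rw [e.symm_apply_apply]; exact hx
  refine ⟨fun i x ↦ F i (e x), fun i ↦ ?_, fun i x hx ↦ hFu i (e x) (hmem i x hx), fun i j x hx ↦ ?_⟩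
  · exact (hFc i).comp e.continuous.continuousOn fun x hx ↦ hmem i x hx
  · have h := hFeq i j (e x) ⟨hmem i x hx.1, hmem j x hx.2⟩
    have h' : 𝓖.g i j (e x) = V.coordChange i j x := by
      show V.coordChange i j (e.symm (e x)) = _
      rw [e.symm_apply_apply]
    rw [← h', h]

/-- **Grauert's Oka principle, existence half, over the model space `E ≅ ℂⁿ`**: every `C^∞`
complex vector bundle over `E` is topologically equivalent to a HOLOMORPHIC cocycle on the same
cover — regauge by `c_i = F_i⁻¹`, which makes every transition matrix `≡ 1`. (FG Ch. V §1.5 (1) for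
`X = ℂⁿ`; Leiterer Cor. 3.3 (ii) for `X = ℂⁿ`.) [cite: FritzscheGrauert2002, Ch. V §1.5 (1) (the case X = ℂⁿ)] -/
theorem grauert_oka_exists_holomorphic_modelSpace (V : SmoothComplexVectorBundle ι E E r) :
    ∃ V' : SmoothComplexVectorBundle ι E E r, V'.IsHolomorphic ∧ TopologicallyEquivalent V V' := by
  classical
  obtain ⟨F, hFc, hFu, hFeq⟩ := exists_continuous_coboundary_self V
  haveI : CompleteSpace (Matrix (Fin r) (Fin r) ℂ) := FiniteDimensional.complete ℂ _
  refine exists_isHolomorphic_topologicallyEquivalent_of_cochain V id V.baseSet V.isOpen_baseSet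
    V.exists_mem_baseSet (fun k ↦ Subset.rfl) (fun k x ↦ Ring.inverse (F k x)) (fun k ↦ ?_)
    (fun k x hx ↦ (hFu k x hx).ringInverse) (fun k l a b ↦ ?_)
  · exact Literature.Analysis.Complex.continuousOn_ringInverse_comp (hFc k) (hFu k)
  · -- the regauged transition matrices are identically `1`
    refine (mdifferentiableOn_const (c := (1 : Matrix (Fin r) (Fin r) ℂ) a b)).congr fun x hx ↦ ?_
    show (Ring.inverse (F k x) * V.coordChange k l x * (Ring.inverse (F l x))⁻¹) a b =
      (1 : Matrix (Fin r) (Fin r) ℂ) a b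
    rw [hFeq k l x hx, Matrix.nonsing_inv_eq_ringInverse, Ring.inverse_inverse (hFu l x hx.2),
      ← mul_assoc, Ring.inverse_mul_cancel _ (hFu k x hx.1), one_mul,
      Ring.inverse_mul_cancel _ (hFu l x hx.2)]

/-- **The named fact `grauert_oka_exists_holomorphic` in the case `M := E`** (its exact shape: an
index type in the universe of `M`, here `range baseSet`). The Stein hypothesis is automatic
(`isSteinManifold_self`) and not used. [cite: FritzscheGrauert2002, Ch. V §1.5 (1) (the case X = ℂⁿ)] -/
theorem grauert_oka_exists_holomorphic_of_modelSpace (V : SmoothComplexVectorBundle ι E E r) :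
    ∃ (ι' : Type u) (V' : SmoothComplexVectorBundle ι' E E r),
      V'.IsHolomorphic ∧ TopologicallyEquivalent V V' := by
  obtain ⟨V', hV', hVV'⟩ := grauert_oka_exists_holomorphic_modelSpace V
  exact ⟨_, V'.reindexRange, hV'.reindexRange, hVV'.trans (topologicallyEquivalent_reindexRange V')⟩

/-! ### Bases homeomorphic to `ℂⁿ` -/

section Homeomorph

universe v

variable {M : Type v} [TopologicalSpace M] [ChartedSpace E M] [IsManifold 𝓘(ℂ, E) ω M]

omit [FiniteDimensional ℂ E] [IsManifold 𝓘(ℂ, E) ω M] in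
/-- **Bundles over a base homeomorphic to `ℂⁿ` are topologically trivial, cocycle form**: if the
complex manifold `M` is homeomorphic to `ℂⁿ` (e.g. `M` an open ball, polydisc or box of `ℂⁿ`, or any
complex manifold whose underlying space is `ℝ^{2n}`), the transition matrices of a `C^∞` complex
vector bundle over `M` form a continuous coboundary `g_{ij} = F_i F_j⁻¹`. Only the topology of `M`
enters (`ContCocycle.exists_continuous_coboundary` transported along the homeomorphism).
[cite: LeitererSCV4, Ch. II Thm. 3.2 (ii) (the case X ≅ ℂⁿ topologically)] -/
theorem exists_continuous_coboundary_of_homeomorph {n : ℕ} (φ : M ≃ₜ (Fin n → ℂ))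
    (V : SmoothComplexVectorBundle ι E M r) :
    ∃ F : ι → M → Matrix (Fin r) (Fin r) ℂ, (∀ i, ContinuousOn (F i) (V.baseSet i)) ∧
      (∀ i, ∀ x ∈ V.baseSet i, IsUnit (F i x)) ∧
      ∀ i j, ∀ x ∈ V.baseSet i ∩ V.baseSet j, V.coordChange i j x = F i x * Ring.inverse (F j x) := by
  classical
  haveI : CompleteSpace (Matrix (Fin r) (Fin r) ℂ) := FiniteDimensional.complete ℂ _
  -- continuity of the matrix-valued transition functions
  have hcont : ∀ i j, ContinuousOn (V.coordChange i j) (V.baseSet i ∩ V.baseSet j) := by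
    intro i j
    refine continuousOn_pi.2 fun a ↦ continuousOn_pi.2 fun b ↦ ?_
    exact (V.contMDiffOn_coordChange i j a b).continuousOn
  -- the transported continuous cocycle on `ℂⁿ`
  let 𝓖 : Literature.Analysis.Complex.ContCocycle (Fin n) (Matrix (Fin r) (Fin r) ℂ) ι :=
    { U := fun i ↦ φ.symm ⁻¹' V.baseSet i
      isOpen_U := fun i ↦ (V.isOpen_baseSet i).preimage φ.symm.continuous
      exists_mem := fun z ↦ V.exists_mem_baseSet (φ.symm z)
      g := fun i j z ↦ V.coordChange i j (φ.symm z)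
      continuousOn_g := fun i j ↦ (hcont i j).comp φ.symm.continuous.continuousOn fun _ hz ↦ hz
      g_self := fun i z hz ↦ V.coordChange_self i _ hz
      g_comp := fun i j k z hz ↦ V.coordChange_comp i j k _ hz }
  obtain ⟨F, hFc, hFu, hFeq⟩ := 𝓖.exists_continuous_coboundary
  have hmem : ∀ i x, x ∈ V.baseSet i → φ x ∈ 𝓖.U i := fun i x hx ↦ by
    show φ.symm (φ x) ∈ V.baseSet i
    rw [φ.symm_apply_apply]; exact hx
  refine ⟨fun i x ↦ F i (φ x), fun i ↦ ?_, fun i x hx ↦ hFu i (φ x) (hmem i x hx), fun i j x hx ↦ ?_⟩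
  · exact (hFc i).comp φ.continuous.continuousOn fun x hx ↦ hmem i x hx
  · have h := hFeq i j (φ x) ⟨hmem i x hx.1, hmem j x hx.2⟩
    have h' : 𝓖.g i j (φ x) = V.coordChange i j x := by
      show V.coordChange i j (φ.symm (φ x)) = _
      rw [φ.symm_apply_apply]
    rw [← h', h]

/-- **Grauert's Oka principle, existence half, over a base homeomorphic to `ℂⁿ`**: on a complex
manifold `M` homeomorphic to `ℂⁿ` (any `E`-charted complex structure on `ℝ^{2n}`: balls, polydiscs,
boxes, `ℂⁿ` with exotic charts, …) every `C^∞` complex vector bundle is topologically equivalent to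
a holomorphic cocycle on the same cover (regauging by `F_i⁻¹` makes the transition matrices `≡ 1`).
[cite: FritzscheGrauert2002, Ch. V §1.5 (1) (the case X ≅ ℂⁿ topologically)] -/
theorem grauert_oka_exists_holomorphic_of_homeomorph {n : ℕ} (φ : M ≃ₜ (Fin n → ℂ))
    (V : SmoothComplexVectorBundle ι E M r) :
    ∃ V' : SmoothComplexVectorBundle ι E M r, V'.IsHolomorphic ∧ TopologicallyEquivalent V V' := by
  classical
  obtain ⟨F, hFc, hFu, hFeq⟩ := exists_continuous_coboundary_of_homeomorph φ V
  haveI : CompleteSpace (Matrix (Fin r) (Fin r) ℂ) := FiniteDimensional.complete ℂ _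
  refine exists_isHolomorphic_topologicallyEquivalent_of_cochain V id V.baseSet V.isOpen_baseSet
    V.exists_mem_baseSet (fun k ↦ Subset.rfl) (fun k x ↦ Ring.inverse (F k x)) (fun k ↦ ?_)
    (fun k x hx ↦ (hFu k x hx).ringInverse) (fun k l a b ↦ ?_)
  · exact Literature.Analysis.Complex.continuousOn_ringInverse_comp (hFc k) (hFu k)
  · refine (mdifferentiableOn_const (c := (1 : Matrix (Fin r) (Fin r) ℂ) a b)).congr fun x hx ↦ ?_
    show (Ring.inverse (F k x) * V.coordChange k l x * (Ring.inverse (F l x))⁻¹) a b =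
      (1 : Matrix (Fin r) (Fin r) ℂ) a b
    rw [hFeq k l x hx, Matrix.nonsing_inv_eq_ringInverse, Ring.inverse_inverse (hFu l x hx.2),
      ← mul_assoc, Ring.inverse_mul_cancel _ (hFu k x hx.1), one_mul,
      Ring.inverse_mul_cancel _ (hFu l x hx.2)]

/-- **The named fact `grauert_oka_exists_holomorphic` for bases homeomorphic to `ℂⁿ`**, in its exact
shape (index type in the universe of `M`, via `reindexRange`); the Stein hypothesis is not used.
[cite: FritzscheGrauert2002, Ch. V §1.5 (1) (the case X ≅ ℂⁿ topologically)] -/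
theorem grauert_oka_exists_holomorphic_of_homeomorph' {n : ℕ} (φ : M ≃ₜ (Fin n → ℂ))
    (V : SmoothComplexVectorBundle ι E M r) :
    ∃ (ι' : Type v) (V' : SmoothComplexVectorBundle ι' E M r),
      V'.IsHolomorphic ∧ TopologicallyEquivalent V V' := by
  obtain ⟨V', hV', hVV'⟩ := grauert_oka_exists_holomorphic_of_homeomorph φ V
  exact ⟨_, V'.reindexRange, hV'.reindexRange, hVV'.trans (topologicallyEquivalent_reindexRange V')⟩

end Homeomorph

end SmoothComplexVectorBundle

end Literature.Geometry.Kaehler
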